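import Mathlib
import HarnessLib
import Summits.HubbardSuperconductivity.HubbardSuperconductivity.Theorems.KLProgrammeThermalGreenHubbardTorus

/-!
# The re-amputated Matsubara Green function of the Hubbard torus is EXACTLY `U·⟨{T_k, c†_k}⟩ − U²·∫₀^β e^{ik₀τ}⟨T_k(τ)T_k†⟩dτ`,
# hence `O(U)` uniformly in the volume, the momentum and the frequency, for EVERY coupling (seat hubbard-kl-k3c5-p2, g2)

Route `KLProgramme`, child 5 `KLRegimeVolumeLimitV11` (stmt-HubbardSuperconductivity-19826), clause (i) of the volume-limit text.  Sharpening of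
`…ThermalGreenHubbardTorus.norm_reamputated_matsubaraGreen_le` (which gave an `O_β(1)` bound): with `H' = H − μN` on the `L × L` torus,
`ξ = ε_L(k) − μ`, `c = c_{k↑}`, the DRESSED mode `T = (Σ_z L⁻¹χ_k(z) n_{z↓} c†_{z↑})ᴴ` of `HubbardMomentumModeCommutators`
(`[H', c] = −ξ c − U T`, `‖T‖ ≤ 1`), a fermionic frequency `k₀` (`e^{ik₀β} = −1`) and

  `𝒢 = ∫₀^β e^{ik₀τ}⟨c(τ)c†⟩_{H'} dτ`,  `𝒴 = ∫₀^β e^{ik₀τ}⟨T(τ)c†⟩ dτ`,  `𝒵 = ∫₀^β e^{ik₀τ}⟨T(τ)T†⟩ dτ`,  `ĝ = 1/(−ik₀ + ξ)`,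

ONE Matsubara integration by parts each (`fermionic_matsubara_ibp`, KMS) and the derivative-moving identity (`gibbsState_imagTimeEvolve_comm_mul`)
give the two EXACT Schwinger–Dyson relations `𝒢·(−ik₀ + ξ) = 1 − U𝒴` and `𝒴·(−ik₀ + ξ) = ⟨Tc† + c†T⟩ − U𝒵` (`matsubara_dyson`), whence

  `(ĝ − 𝒢)·(−ik₀ + ξ)² = U·⟨Tc† + c†T⟩ − U²·𝒵`   (`reamputated_matsubaraGreen_eq`)

and, by the Gibbs two-time bound, **`‖(ĝ − 𝒢)(−ik₀ + ξ)²‖ ≤ |U|·(2 + β|U|)`** for every real `U`, every `L ≥ 3`, every torus momentum and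
every fermionic frequency (`norm_reamputated_matsubaraGreen_le_linear`).  This is the `M = ∞` shadow of the carrier of `FinalTwoLegVolLimit`
(`Σ̂ = (ĝ − G)/ĝ²`, `…VolumeLimitFrameReduction`): bounded by `|U|(2 + β|U|)` with no expansion and no smallness.  Everything is proved; no definition.
-/

noncomputable section

namespace Summit.HubbardSuperconductivity.HubbardSuperconductivity.Theorems.ThermalGreen

set_option linter.dupNamespace false -- summit = problem name (single-conjunct summit), D-0017

open scoped Matrix.Norms.L2Operator ComplexConjugate ComplexOrder
open Matrix Complex MeasureTheory intervalIntegral Literature.MathematicalPhysics.QuantumLattice Literature.Probability.LatticeModels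
open HubbardWave0

/-! ## §1 Linearity of the Matsubara transform in both slots -/

section Generic

variable {n : Type*} [Fintype n] [DecidableEq n]

/-- `(a•X + b•Z)(s) = a•X(s) + b•Z(s)`. -/
theorem imagTimeEvolve_lin (H : Matrix n n ℂ) (s a b : ℂ) (X Z : Matrix n n ℂ) :
    imagTimeEvolve H s (a • X + b • Z) = a • imagTimeEvolve H s X + b • imagTimeEvolve H s Z := by
  rw [imagTimeEvolve_add_op, imagTimeEvolve_smul, imagTimeEvolve_smul]

/-- Linearity of `X ↦ ∫₀^β e^{ikτ}⟨X(τ)Y⟩dτ`. -/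
theorem matsubara_lin_left (β : ℝ) (H X Z Y : Matrix n n ℂ) (a b : ℂ) (k : ℝ) :
    ∫ τ in (0 : ℝ)..β, cexp (I * k * τ) * gibbsState β H (imagTimeEvolve H (τ : ℂ) (a • X + b • Z) * Y) =
      a * (∫ τ in (0 : ℝ)..β, cexp (I * k * τ) * gibbsState β H (imagTimeEvolve H (τ : ℂ) X * Y)) +
        b * ∫ τ in (0 : ℝ)..β, cexp (I * k * τ) * gibbsState β H (imagTimeEvolve H (τ : ℂ) Z * Y) := by
  have hc : ∀ W : Matrix n n ℂ, Continuous fun τ : ℝ => cexp (I * k * τ) * gibbsState β H (imagTimeEvolve H (τ : ℂ) W * Y) :=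
    fun W => (Complex.continuous_exp.comp (continuous_const.mul Complex.continuous_ofReal)).mul
      (continuous_gibbsState_imagTimeEvolve_mul β H W Y)
  have hpt : ∀ τ : ℝ, cexp (I * k * τ) * gibbsState β H (imagTimeEvolve H (τ : ℂ) (a • X + b • Z) * Y) =
      a * (cexp (I * k * τ) * gibbsState β H (imagTimeEvolve H (τ : ℂ) X * Y)) +
        b * (cexp (I * k * τ) * gibbsState β H (imagTimeEvolve H (τ : ℂ) Z * Y)) := by
    intro τ
    rw [imagTimeEvolve_lin, Matrix.add_mul, Matrix.smul_mul, Matrix.smul_mul, map_add, map_smul, map_smul, smul_eq_mul, smul_eq_mul]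
    ring
  simp_rw [hpt]
  rw [intervalIntegral.integral_add (((hc X).const_mul a).intervalIntegrable _ _) (((hc Z).const_mul b).intervalIntegrable _ _),
    intervalIntegral.integral_const_mul, intervalIntegral.integral_const_mul]

/-- Linearity of `Y ↦ ∫₀^β e^{ikτ}⟨X(τ)Y⟩dτ`. -/
theorem matsubara_lin_right (β : ℝ) (H X Y W : Matrix n n ℂ) (a b : ℂ) (k : ℝ) :
    ∫ τ in (0 : ℝ)..β, cexp (I * k * τ) * gibbsState β H (imagTimeEvolve H (τ : ℂ) X * (a • Y + b • W)) =
      a * (∫ τ in (0 : ℝ)..β, cexp (I * k * τ) * gibbsState β H (imagTimeEvolve H (τ : ℂ) X * Y)) +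
        b * ∫ τ in (0 : ℝ)..β, cexp (I * k * τ) * gibbsState β H (imagTimeEvolve H (τ : ℂ) X * W) := by
  have hc : ∀ V : Matrix n n ℂ, Continuous fun τ : ℝ => cexp (I * k * τ) * gibbsState β H (imagTimeEvolve H (τ : ℂ) X * V) :=
    fun V => (Complex.continuous_exp.comp (continuous_const.mul Complex.continuous_ofReal)).mul
      (continuous_gibbsState_imagTimeEvolve_mul β H X V)
  have hpt : ∀ τ : ℝ, cexp (I * k * τ) * gibbsState β H (imagTimeEvolve H (τ : ℂ) X * (a • Y + b • W)) =
      a * (cexp (I * k * τ) * gibbsState β H (imagTimeEvolve H (τ : ℂ) X * Y)) +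
        b * (cexp (I * k * τ) * gibbsState β H (imagTimeEvolve H (τ : ℂ) X * W)) := by
    intro τ
    rw [Matrix.mul_add, Matrix.mul_smul, Matrix.mul_smul, map_add, map_smul, map_smul, smul_eq_mul, smul_eq_mul]
    ring
  simp_rw [hpt]
  rw [intervalIntegral.integral_add (((hc Y).const_mul a).intervalIntegrable _ _) (((hc W).const_mul b).intervalIntegrable _ _),
    intervalIntegral.integral_const_mul, intervalIntegral.integral_const_mul]

end Generic

/-! ## §2 The two exact Schwinger–Dyson relations on the torus -/

variable {L : ℕ} [NeZero L]

/-- `[H − μN, c†_{k↑}] = (ε_L(k) − μ) c†_{k↑} + U T†` (adjoint of `hubbardTorusWith_commutator_momentumAnnihilation`). -/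
theorem hubbardTorusWith_commutator_momentumCreation (hL : 3 ≤ L) (U μ : ℝ) (k : TorusSite 2 L) :
    hubbardTorusWith 2 L 1 U μ * momentumCreation k 0 - momentumCreation k 0 * hubbardTorusWith 2 L 1 U μ =
      ((torusBand L k - μ : ℝ) : ℂ) • momentumCreation k 0 +
        (U : ℂ) • (∑ z : FermionTorus 2 L, (torusFourierWeight 2 L * torusChar k z.toTorusSite) • (numberOp z 1 * creation (orb z 0))) := by
  have hH : (hubbardTorusWith 2 L 1 U μ)ᴴ = hubbardTorusWith 2 L 1 U μ := (isHermitian_hamiltonianWith (fermionTorusGraph 2 L) 1 U μ).eq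
  have h := congrArg conjTranspose (hubbardTorusWith_commutator_momentumAnnihilation hL U μ k)
  rw [conjTranspose_sub, conjTranspose_mul, conjTranspose_mul, momentumAnnihilation_conjTranspose, hH, conjTranspose_sub, conjTranspose_neg,
    conjTranspose_smul, conjTranspose_smul, momentumAnnihilation_conjTranspose, conjTranspose_conjTranspose] at h
  have hs1 : star ((torusBand L k - μ : ℝ) : ℂ) = ((torusBand L k - μ : ℝ) : ℂ) := Complex.conj_ofReal _
  have hs2 : star (U : ℂ) = (U : ℂ) := Complex.conj_ofReal _
  rw [hs1, hs2] at h
  -- `h : c† H − H c† = −(ξ • c†) − U • T†`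
  rw [← neg_sub, h]
  abel

/-- **The two Schwinger–Dyson relations.**  With `H' = H − μN`, `c = c_{k↑}`, `T = (Σ_z L⁻¹χ_k(z) n_{z↓}c†_{z↑})ᴴ`, `ξ = ε_L(k) − μ` and a fermionic
`k₀`: (1) `𝒢·(−ik₀ + ξ) = 1 − U·𝒴` and (2) `𝒴·(−ik₀ + ξ) = ⟨Tc† + c†T⟩ − U·𝒵`. -/
theorem matsubara_dyson (hL : 3 ≤ L) (U μ β : ℝ) (k : TorusSite 2 L) {k₀ : ℝ} (hk : cexp (I * k₀ * β) = -1) :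
    (∫ τ in (0 : ℝ)..β, cexp (I * k₀ * τ) * gibbsState β (hubbardTorusWith 2 L 1 U μ)
          (imagTimeEvolve (hubbardTorusWith 2 L 1 U μ) (τ : ℂ) (momentumAnnihilation k 0) * momentumCreation k 0)) *
        (-I * k₀ + ((torusBand L k - μ : ℝ) : ℂ)) =
      1 - (U : ℂ) * ∫ τ in (0 : ℝ)..β, cexp (I * k₀ * τ) * gibbsState β (hubbardTorusWith 2 L 1 U μ)
        (imagTimeEvolve (hubbardTorusWith 2 L 1 U μ) (τ : ℂ)
            (∑ z : FermionTorus 2 L, (torusFourierWeight 2 L * torusChar k z.toTorusSite) • (numberOp z 1 * creation (orb z 0)))ᴴ *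
          momentumCreation k 0) ∧
    (∫ τ in (0 : ℝ)..β, cexp (I * k₀ * τ) * gibbsState β (hubbardTorusWith 2 L 1 U μ)
          (imagTimeEvolve (hubbardTorusWith 2 L 1 U μ) (τ : ℂ)
              (∑ z : FermionTorus 2 L, (torusFourierWeight 2 L * torusChar k z.toTorusSite) • (numberOp z 1 * creation (orb z 0)))ᴴ *
            momentumCreation k 0)) *
        (-I * k₀ + ((torusBand L k - μ : ℝ) : ℂ)) =
      gibbsState β (hubbardTorusWith 2 L 1 U μ)
          ((∑ z : FermionTorus 2 L, (torusFourierWeight 2 L * torusChar k z.toTorusSite) • (numberOp z 1 * creation (orb z 0)))ᴴ *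
              momentumCreation k 0 +
            momentumCreation k 0 *
              (∑ z : FermionTorus 2 L, (torusFourierWeight 2 L * torusChar k z.toTorusSite) • (numberOp z 1 * creation (orb z 0)))ᴴ) -
        (U : ℂ) * ∫ τ in (0 : ℝ)..β, cexp (I * k₀ * τ) * gibbsState β (hubbardTorusWith 2 L 1 U μ)
          (imagTimeEvolve (hubbardTorusWith 2 L 1 U μ) (τ : ℂ)
              (∑ z : FermionTorus 2 L, (torusFourierWeight 2 L * torusChar k z.toTorusSite) • (numberOp z 1 * creation (orb z 0)))ᴴ *
            (∑ z : FermionTorus 2 L, (torusFourierWeight 2 L * torusChar k z.toTorusSite) • (numberOp z 1 * creation (orb z 0)))ᴴᴴ) := by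
  have hkc : (k₀ : ℂ) ≠ 0 := by exact_mod_cast ne_zero_of_cexp_eq_neg_one hk
  have hik : (I * k₀ : ℂ) ≠ 0 := mul_ne_zero I_ne_zero hkc
  set H' : Matrix (Finset (Orb (FermionTorus 2 L))) (Finset (Orb (FermionTorus 2 L))) ℂ := hubbardTorusWith 2 L 1 U μ with hH'
  set A : Matrix (Finset (Orb (FermionTorus 2 L))) (Finset (Orb (FermionTorus 2 L))) ℂ := momentumAnnihilation k 0 with hA
  set B : Matrix (Finset (Orb (FermionTorus 2 L))) (Finset (Orb (FermionTorus 2 L))) ℂ := momentumCreation k 0 with hB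
  set Td : Matrix (Finset (Orb (FermionTorus 2 L))) (Finset (Orb (FermionTorus 2 L))) ℂ :=
    (∑ z : FermionTorus 2 L, (torusFourierWeight 2 L * torusChar k z.toTorusSite) • (numberOp z 1 * creation (orb z 0)))ᴴ with hTd
  set ξ : ℂ := ((torusBand L k - μ : ℝ) : ℂ) with hξ
  set G : ℂ := ∫ τ in (0 : ℝ)..β, cexp (I * k₀ * τ) * gibbsState β H' (imagTimeEvolve H' (τ : ℂ) A * B) with hG
  set Y : ℂ := ∫ τ in (0 : ℝ)..β, cexp (I * k₀ * τ) * gibbsState β H' (imagTimeEvolve H' (τ : ℂ) Td * B) with hY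
  set Z : ℂ := ∫ τ in (0 : ℝ)..β, cexp (I * k₀ * τ) * gibbsState β H' (imagTimeEvolve H' (τ : ℂ) Td * Tdᴴ) with hZ
  -- the commutators as linear combinations
  have hcA : H' * A - A * H' = (-ξ) • A + (-(U : ℂ)) • Td := by
    rw [hH', hA, hTd, hubbardTorusWith_commutator_momentumAnnihilation hL U μ k, neg_smul, neg_smul, sub_eq_add_neg]
  have hcB : H' * B - B * H' = ξ • B + (U : ℂ) • Tdᴴ := by
    rw [hH', hB, hTd, hubbardTorusWith_commutator_momentumCreation hL U μ k, conjTranspose_conjTranspose]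
  -- (1) one IBP on `⟨c(τ)c†⟩`
  have h1 := fermionic_matsubara_ibp β H' A B hk
  have hcar : gibbsState β H' (A * B + B * A) = 1 := by rw [hH', hA, hB]; exact gibbsState_momentum_car U μ β k
  rw [hcar, hcA, matsubara_lin_left, ← hG, ← hY] at h1
  -- (2) one IBP on `⟨T(τ)c†⟩`, derivative moved onto `c†`
  have h2 := fermionic_matsubara_ibp β H' Td B hk
  have hmove : ∫ τ in (0 : ℝ)..β, cexp (I * k₀ * τ) * gibbsState β H' (imagTimeEvolve H' (τ : ℂ) (H' * Td - Td * H') * B) =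
      -(ξ * Y + (U : ℂ) * Z) := by
    have hpt : ∀ τ : ℝ, cexp (I * k₀ * τ) * gibbsState β H' (imagTimeEvolve H' (τ : ℂ) (H' * Td - Td * H') * B) =
        -(cexp (I * k₀ * τ) * gibbsState β H' (imagTimeEvolve H' (τ : ℂ) Td * (H' * B - B * H'))) := fun τ => by
      rw [gibbsState_imagTimeEvolve_comm_mul, mul_neg]
    simp_rw [hpt]
    rw [intervalIntegral.integral_neg, hcB, matsubara_lin_right, ← hY, ← hZ]
  rw [hmove, ← hY] at h2
  constructor
  · -- from `h1 : G = -1/(ik₀) - (ik₀)⁻¹ * (-ξ * G + -U * Y)`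
    have h1' := h1
    field_simp at h1'
    have e1 : G * (I * k₀) = -1 + ξ * G + (U : ℂ) * Y := by linear_combination h1'
    linear_combination -e1
  · have h2' := h2
    field_simp at h2'
    have e2 : Y * (I * k₀) = -gibbsState β H' (Td * B + B * Td) + ξ * Y + (U : ℂ) * Z := by linear_combination h2'
    linear_combination -e2

/-! ## §3 The exact formula and the `O(U)` bound -/

/-- **EXACT: the re-amputated Green function is `U⟨{T,c†}⟩ − U²𝒵`.**  For `L ≥ 3`, every real `U, μ, β`, every torus momentum and every
fermionic `k₀`: `(ĝ − 𝒢)·(−ik₀ + ξ)² = U·⟨Tc† + c†T⟩_{H'} − U²·∫₀^β e^{ik₀τ}⟨T(τ)T†⟩_{H'}dτ`. -/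
theorem reamputated_matsubaraGreen_eq (hL : 3 ≤ L) (U μ β : ℝ) (k : TorusSite 2 L) {k₀ : ℝ} (hk : cexp (I * k₀ * β) = -1) :
    (1 / (-I * k₀ + ((torusBand L k - μ : ℝ) : ℂ)) -
          ∫ τ in (0 : ℝ)..β, cexp (I * k₀ * τ) * gibbsState β (hubbardTorusWith 2 L 1 U μ)
            (imagTimeEvolve (hubbardTorusWith 2 L 1 U μ) (τ : ℂ) (momentumAnnihilation k 0) * momentumCreation k 0)) *
        (-I * k₀ + ((torusBand L k - μ : ℝ) : ℂ)) ^ 2 =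
      (U : ℂ) * gibbsState β (hubbardTorusWith 2 L 1 U μ)
          ((∑ z : FermionTorus 2 L, (torusFourierWeight 2 L * torusChar k z.toTorusSite) • (numberOp z 1 * creation (orb z 0)))ᴴ *
              momentumCreation k 0 +
            momentumCreation k 0 *
              (∑ z : FermionTorus 2 L, (torusFourierWeight 2 L * torusChar k z.toTorusSite) • (numberOp z 1 * creation (orb z 0)))ᴴ) -
        (U : ℂ) ^ 2 * ∫ τ in (0 : ℝ)..β, cexp (I * k₀ * τ) * gibbsState β (hubbardTorusWith 2 L 1 U μ)
          (imagTimeEvolve (hubbardTorusWith 2 L 1 U μ) (τ : ℂ)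
              (∑ z : FermionTorus 2 L, (torusFourierWeight 2 L * torusChar k z.toTorusSite) • (numberOp z 1 * creation (orb z 0)))ᴴ *
            (∑ z : FermionTorus 2 L, (torusFourierWeight 2 L * torusChar k z.toTorusSite) • (numberOp z 1 * creation (orb z 0)))ᴴᴴ) := by
  obtain ⟨e1, e2⟩ := matsubara_dyson hL U μ β k hk
  have hkr : k₀ ≠ 0 := ne_zero_of_cexp_eq_neg_one hk
  set D : ℂ := -I * k₀ + ((torusBand L k - μ : ℝ) : ℂ) with hD
  have hDne : D ≠ 0 := by
    intro h
    have := congrArg Complex.im h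
    simp [hD] at this
    exact hkr this
  set G : ℂ := ∫ τ in (0 : ℝ)..β, cexp (I * k₀ * τ) * gibbsState β (hubbardTorusWith 2 L 1 U μ)
    (imagTimeEvolve (hubbardTorusWith 2 L 1 U μ) (τ : ℂ) (momentumAnnihilation k 0) * momentumCreation k 0) with hG
  have hred : (1 / D - G) * D ^ 2 = D - (G * D) * D := by
    rw [sub_mul, pow_two, ← mul_assoc, ← mul_assoc, one_div_mul_cancel hDne, one_mul]
  rw [hred, e1]
  linear_combination (U : ℂ) * e2

/-- **`O(U)` BOUND, ALL COUPLINGS, UNIFORM IN VOLUME, MOMENTUM AND FREQUENCY.**  For `L ≥ 3`, `0 ≤ β`, every real `U, μ`, every torus momentum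
`k` and every fermionic `k₀` (`e^{ik₀β} = −1`): `‖(ĝ − 𝒢)(−ik₀ + ξ)²‖ ≤ |U|·(2 + β|U|)`. -/
theorem norm_reamputated_matsubaraGreen_le_linear (hL : 3 ≤ L) (U μ : ℝ) {β : ℝ} (hβ : 0 ≤ β) (k : TorusSite 2 L) {k₀ : ℝ}
    (hk : cexp (I * k₀ * β) = -1) :
    ‖(1 / (-I * k₀ + ((torusBand L k - μ : ℝ) : ℂ)) -
          ∫ τ in (0 : ℝ)..β, cexp (I * k₀ * τ) * gibbsState β (hubbardTorusWith 2 L 1 U μ)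
            (imagTimeEvolve (hubbardTorusWith 2 L 1 U μ) (τ : ℂ) (momentumAnnihilation k 0) * momentumCreation k 0)) *
        (-I * k₀ + ((torusBand L k - μ : ℝ) : ℂ)) ^ 2‖ ≤ |U| * (2 + β * |U|) := by
  haveI : Nonempty (Finset (Orb (FermionTorus 2 L))) := ⟨∅⟩
  have hH := isHermitian_hamiltonianWith (fermionTorusGraph 2 L) 1 U μ
  rw [reamputated_matsubaraGreen_eq hL U μ β k hk]
  set Td : Matrix (Finset (Orb (FermionTorus 2 L))) (Finset (Orb (FermionTorus 2 L))) ℂ :=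
    (∑ z : FermionTorus 2 L, (torusFourierWeight 2 L * torusChar k z.toTorusSite) • (numberOp z 1 * creation (orb z 0)))ᴴ with hTd
  have hTn : ‖Td‖ ≤ 1 := norm_dressed_conjTranspose_le_one k
  have hTn' : ‖Tdᴴ‖ ≤ 1 := by rw [Matrix.l2_opNorm_conjTranspose]; exact hTn
  have hB : ‖(momentumCreation k 0 : Matrix (Finset (Orb (FermionTorus 2 L))) _ ℂ)‖ ≤ 1 := norm_momentumCreation_le_one k 0
  have hm : ‖gibbsState β (hubbardTorusWith 2 L 1 U μ) (Td * momentumCreation k 0 + momentumCreation k 0 * Td)‖ ≤ 2 := by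
    refine (norm_gibbsState_le (H := hubbardTorusWith 2 L 1 U μ) hH β _).trans ?_
    calc ‖Td * momentumCreation k 0 + momentumCreation k 0 * Td‖
        ≤ ‖Td‖ * ‖(momentumCreation k 0 : Matrix (Finset (Orb (FermionTorus 2 L))) _ ℂ)‖ +
            ‖(momentumCreation k 0 : Matrix (Finset (Orb (FermionTorus 2 L))) _ ℂ)‖ * ‖Td‖ :=
          (norm_add_le _ _).trans (add_le_add (norm_mul_le _ _) (norm_mul_le _ _))
      _ ≤ 1 * 1 + 1 * 1 := by gcongr
      _ = 2 := by norm_num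
  have hZ : ‖∫ τ in (0 : ℝ)..β, cexp (I * k₀ * τ) * gibbsState β (hubbardTorusWith 2 L 1 U μ)
      (imagTimeEvolve (hubbardTorusWith 2 L 1 U μ) (τ : ℂ) Td * Tdᴴ)‖ ≤ β := by
    refine (norm_fermionic_matsubara_le (H := hubbardTorusWith 2 L 1 U μ) hH hβ Td Tdᴴ k₀).trans ?_
    calc β * (‖Td‖ * ‖Tdᴴ‖) ≤ β * (1 * 1) := by gcongr
      _ = β := by ring
  calc ‖(U : ℂ) * gibbsState β (hubbardTorusWith 2 L 1 U μ) (Td * momentumCreation k 0 + momentumCreation k 0 * Td) -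
          (U : ℂ) ^ 2 * ∫ τ in (0 : ℝ)..β, cexp (I * k₀ * τ) * gibbsState β (hubbardTorusWith 2 L 1 U μ)
            (imagTimeEvolve (hubbardTorusWith 2 L 1 U μ) (τ : ℂ) Td * Tdᴴ)‖
      ≤ ‖(U : ℂ)‖ * 2 + ‖(U : ℂ)‖ ^ 2 * β := by
        refine (norm_sub_le _ _).trans (add_le_add ?_ ?_)
        · rw [norm_mul]; gcongr
        · rw [norm_mul, norm_pow]; gcongr
    _ = |U| * (2 + β * |U|) := by rw [Complex.norm_real, Real.norm_eq_abs]; ring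

/-- The same at the tree's fermionic frequencies `k₀ = (2m+1)π/β`, `β > 0`: **`‖(ĝ − 𝒢)(−ik₀ + ξ)²‖ ≤ |U|(2 + β|U|)`** for all `L ≥ 3`, `k`, `m`. -/
theorem norm_reamputated_matsubaraGreen_le_linear_fermi (hL : 3 ≤ L) (U μ : ℝ) {β : ℝ} (hβ : 0 < β) (k : TorusSite 2 L) (m : ℤ) :
    ‖(1 / (-I * (fermiMatsubara β m : ℝ) + ((torusBand L k - μ : ℝ) : ℂ)) -
          ∫ τ in (0 : ℝ)..β, cexp (I * (fermiMatsubara β m : ℝ) * τ) * gibbsState β (hubbardTorusWith 2 L 1 U μ)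
            (imagTimeEvolve (hubbardTorusWith 2 L 1 U μ) (τ : ℂ) (momentumAnnihilation k 0) * momentumCreation k 0)) *
        (-I * (fermiMatsubara β m : ℝ) + ((torusBand L k - μ : ℝ) : ℂ)) ^ 2‖ ≤ |U| * (2 + β * |U|) :=
  norm_reamputated_matsubaraGreen_le_linear hL U μ hβ.le k (cexp_fermiMatsubara_mul_beta hβ.ne' m)

end Summit.HubbardSuperconductivity.HubbardSuperconductivity.Theorems.ThermalGreen

end
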